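import Mathlib
import Summits.MatrixMultiplication.MatrixMultiplication.Theorems.SoloBlindTriangleDoubled

/-!
# Solo-blind seat (MatrixMultiplication), s66 — Conjecture T△ for `2d + 2` triangles, two of them simple
(SHARPEST §2T ADDENDUM s66, TRIANGLE.md (R15) Corollary s = 2, CLAIMS c627)

Setting of `SoloBlindTriangleDoubled.lean` (a good family of `d` zero-sum triangles each used twice) plus TWO further
zero-sum triangles `{a', b', c'}`, `{a'', b'', c''}` used once each ("simple" triangles), the whole family good
(no non-empty rainbow selection sums to zero).

* `soloBlind_triangleDoubled_add_two_injective` — the CHAIN case of the one-signed-block lemma: with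
  `E_i = {0, a_i, -b_i}` and the chain `A = {0, a', a' + a''}` the map `(e, x) ↦ Σ_i E_i(e_i) + A(x)` is injective on
  `3^d × 3` points (a coincidence gives `Σ_i (E_i e_i - E_i ẽ_i) = ±ρ` with `ρ ∈ {a', a'', a' + a''}` a non-empty rainbow
  selection from the two simple triangles — signed table `soloBlindTriRep4` — and the pair differences are realisable with
  either sign, table `soloBlindTriRep` of the doubled file).
* `soloBlind_triangleDoubled_add_two_card` — hence `|H| ≥ 3^(d+1) = 3^(n/2)` for such a family of `n = 2d + 2` triangles:
  Conjecture T△ for every family with exactly two simple triangles.  Together with `SoloBlindTriangleDoubled` (`s = 0`) and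
  `SoloBlindTriangleSimpleOne` (`s = 1`, bound `3^(d+1)`) this is T△ for all families with at most two simple triangles;
  from three simples on the chain bound `3^d (s+1)` falls below `3^(d + s/2)` and the conjecture is open (TRIANGLE.md (R16)).
No `ω` content by itself (door I1⁗ bookkeeping).
-/

namespace Summit.MatrixMultiplication.MatrixMultiplication.Theorems

open Finset BigOperators

section TriangleSimpleTwo

variable {H : Type*} [AddCommGroup H] {d : ℕ}

/-- The chain of two simple triangles: `A = {0, a', a' + a''}` as a map `Fin 3 → H`. -/
def soloBlindTriChain2 (a' a'' : H) (x : Fin 3) : H :=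
  ![0, a', a' + a''] x

/-- Signed realisation table for chain differences: `A x - A y = ±(selection from t' + selection from t'')`;
components: (selection in `t'`, selection in `t''`), sign flag (`true` = `+`). -/
def soloBlindTriRep4 (x y : Fin 3) : (Option (Fin 3) × Option (Fin 3)) × Bool :=
  ![![(((none : Option (Fin 3)), (none : Option (Fin 3))), true), ((some 0, none), false), ((some 0, some 0), false)],
    ![((some 0, none), true), ((none, none), true), ((none, some 0), false)],
    ![((some 0, some 0), true), ((none, some 0), true), ((none, none), true)]] x y

/-- Correctness of the signed chain table (no hypothesis needed: chain differences are sums of `a`-entries). -/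
theorem soloBlind_triRep4_val (a' b' c' a'' b'' c'' : H) (x y : Fin 3) :
    (if (soloBlindTriRep4 x y).2 then
        ((soloBlindTriRep4 x y).1.1).elim 0 ![a', b', c'] + ((soloBlindTriRep4 x y).1.2).elim 0 ![a'', b'', c'']
      else -(((soloBlindTriRep4 x y).1.1).elim 0 ![a', b', c'] + ((soloBlindTriRep4 x y).1.2).elim 0 ![a'', b'', c'']))
      = soloBlindTriChain2 a' a'' x - soloBlindTriChain2 a' a'' y := by
  fin_cases x <;> fin_cases y <;> (simp [soloBlindTriRep4, soloBlindTriChain2]; try abel)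

omit [AddCommGroup H] in
/-- The signed chain table records the empty selection (in both simple triangles) only on the diagonal. -/
theorem soloBlind_triRep4_eq_of_none (x y : Fin 3) (h1 : (soloBlindTriRep4 x y).1.1 = none)
    (h2 : (soloBlindTriRep4 x y).1.2 = none) : x = y := by
  fin_cases x <;> fin_cases y <;> simp_all [soloBlindTriRep4]

/-- **Injectivity for `d` doubled pairs plus two simple triangles (chain case of the one-block lemma).** -/
theorem soloBlind_triangleDoubled_add_two_injective (a b c : Fin d → H)
    (hsum : ∀ i, a i + b i + c i = 0) (a' b' c' a'' b'' c'' : H)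
    (hgood2 : ∀ (s t : Fin d → Option (Fin 3)) (o o' : Option (Fin 3)),
      (∑ i, (soloBlindTriVal a b c i (s i) + soloBlindTriVal a b c i (t i)))
          + o.elim 0 ![a', b', c'] + o'.elim 0 ![a'', b'', c''] = 0 →
        (∀ i, s i = none ∧ t i = none) ∧ o = none ∧ o' = none) :
    Function.Injective (fun p : (Fin d → Fin 3) × Fin 3 =>
      (∑ i, soloBlindTriE a b i (p.1 i)) + soloBlindTriChain2 a' a'' p.2) := by
  rintro ⟨f, x⟩ ⟨g, y⟩ hfg
  have hfg' : (∑ i, soloBlindTriE a b i (f i)) + soloBlindTriChain2 a' a'' x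
      = (∑ i, soloBlindTriE a b i (g i)) + soloBlindTriChain2 a' a'' y := hfg
  have hdiff : (∑ i, (soloBlindTriE a b i (f i) - soloBlindTriE a b i (g i)))
      + (soloBlindTriChain2 a' a'' x - soloBlindTriChain2 a' a'' y) = 0 := by
    rw [Finset.sum_sub_distrib]
    have h0 := sub_eq_zero.mpr hfg'
    calc (∑ i, soloBlindTriE a b i (f i)) - (∑ i, soloBlindTriE a b i (g i))
          + (soloBlindTriChain2 a' a'' x - soloBlindTriChain2 a' a'' y)
        = (∑ i, soloBlindTriE a b i (f i)) + soloBlindTriChain2 a' a'' x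
          - ((∑ i, soloBlindTriE a b i (g i)) + soloBlindTriChain2 a' a'' y) := by abel
      _ = 0 := h0
  have hrep4 := soloBlind_triRep4_val a' b' c' a'' b'' c'' x y
  cases hb : (soloBlindTriRep4 x y).2 with
  | true =>
    simp only [hb, if_true] at hrep4
    have key := hgood2 (fun i => (soloBlindTriRep (f i) (g i)).1)
      (fun i => (soloBlindTriRep (f i) (g i)).2) (soloBlindTriRep4 x y).1.1 (soloBlindTriRep4 x y).1.2 (by
        simp only [soloBlind_triRep_val a b c hsum]
        rw [add_assoc, hrep4]; exact hdiff)
    have hf : f = g :=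
      funext fun i => soloBlind_triRep_eq_of_none (f i) (g i) (key.1 i).1 (key.1 i).2
    have hx : x = y := soloBlind_triRep4_eq_of_none x y key.2.1 key.2.2
    subst hf; subst hx; rfl
  | false =>
    simp only [hb, Bool.false_eq_true, if_false] at hrep4
    have hval : ((soloBlindTriRep4 x y).1.1).elim 0 ![a', b', c']
        + ((soloBlindTriRep4 x y).1.2).elim 0 ![a'', b'', c'']
        = -(soloBlindTriChain2 a' a'' x - soloBlindTriChain2 a' a'' y) := by
      rw [← hrep4, neg_neg]
    have hneg : (∑ i, (soloBlindTriE a b i (g i) - soloBlindTriE a b i (f i)))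
        = -(∑ i, (soloBlindTriE a b i (f i) - soloBlindTriE a b i (g i))) := by
      rw [← Finset.sum_neg_distrib]
      exact Finset.sum_congr rfl (fun i _ => (neg_sub _ _).symm)
    have key := hgood2 (fun i => (soloBlindTriRep (g i) (f i)).1)
      (fun i => (soloBlindTriRep (g i) (f i)).2) (soloBlindTriRep4 x y).1.1 (soloBlindTriRep4 x y).1.2 (by
        simp only [soloBlind_triRep_val a b c hsum]
        rw [add_assoc, hval, hneg, ← neg_add, hdiff, neg_zero])
    have hf : f = g :=
      funext fun i => (soloBlind_triRep_eq_of_none (g i) (f i) (key.1 i).1 (key.1 i).2).symm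
    have hx : x = y := soloBlind_triRep4_eq_of_none x y key.2.1 key.2.2
    subst hf; subst hx; rfl

/-- **Conjecture T△ for `2d + 2` triangles with two simples: `|H| ≥ 3^(d+1) = 3^(n/2)`.** -/
theorem soloBlind_triangleDoubled_add_two_card [Fintype H] (a b c : Fin d → H)
    (hsum : ∀ i, a i + b i + c i = 0) (a' b' c' a'' b'' c'' : H)
    (hgood2 : ∀ (s t : Fin d → Option (Fin 3)) (o o' : Option (Fin 3)),
      (∑ i, (soloBlindTriVal a b c i (s i) + soloBlindTriVal a b c i (t i)))
          + o.elim 0 ![a', b', c'] + o'.elim 0 ![a'', b'', c''] = 0 →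
        (∀ i, s i = none ∧ t i = none) ∧ o = none ∧ o' = none) :
    3 ^ (d + 1) ≤ Fintype.card H := by
  classical
  have h := Fintype.card_le_of_injective _
    (soloBlind_triangleDoubled_add_two_injective a b c hsum a' b' c' a'' b'' c'' hgood2)
  simpa [Fintype.card_prod, Fintype.card_fun, Fintype.card_fin, pow_succ] using h

end TriangleSimpleTwo

end Summit.MatrixMultiplication.MatrixMultiplication.Theorems
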